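import Mathlib
import Literature.Analysis.FluidPDE.HalfLineOUComparison
import Literature.Analysis.FluidPDE.HalfLineOUViscosity
import Summits.NavierStokesRegularity.NavierStokesRegularity.Theorems.UnthreadedDoorNetFluxTypeIVorticityBound
import Summits.NavierStokesRegularity.NavierStokesRegularity.Theorems.UnthreadedDoorNetFluxOscLeVorticity
import Summits.NavierStokesRegularity.NavierStokesRegularity.Theorems.UnthreadedDoorNetFluxDefs
import Summits.NavierStokesRegularity.NavierStokesRegularity.Theorems.UnthreadedDoorNetFluxEnvelopeDefs
import Summits.NavierStokesRegularity.NavierStokesRegularity.Theorems.UnthreadedDoorNetFluxEnvelopeFacts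
import Summits.NavierStokesRegularity.NavierStokesRegularity.Theorems.UnthreadedDoorNetFluxNearCentreFlux
import Summits.NavierStokesRegularity.NavierStokesRegularity.Theorems.UnthreadedDoorNetFluxWindowDecayViscosity
import Summits.NavierStokesRegularity.NavierStokesRegularity.Theorems.UnthreadedDoorNetFluxOneSidedLaw
import Summits.NavierStokesRegularity.NavierStokesRegularity.Theorems.UnthreadedDoorNetFluxExtremalHeadEMF
import Summits.NavierStokesRegularity.NavierStokesRegularity.Theorems.UnthreadedDoorNetFluxUnimodalScalarLiouville
import Summits.NavierStokesRegularity.NavierStokesRegularity.Theorems.UnthreadedDoorCapSymHeadPotential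
import Summits.NavierStokesRegularity.NavierStokesRegularity.Cruxes.PoloidalLiouville.NetFluxTransportSketch

/-!
# LINE «netflux-typei-gap» v10 (= v5 VISCOSITY interface; ALL five stubs closed BY NAME, 0 sorry — RUNG assembled) — registered skeleton (RUNG FILE) on crux stmt-NavierStokesRegularity-1222
# `PoloidalLiouville` (wall W1, wall stub `stub_scalarLiouville`), planner ns-idea-14 g3; KEY-NS #153 (c), KEY-NS #157

**What this file concludes.**  The kernel-checked composition `UnimodalScalarLiouvilleTypeI_of` concludes the
STRATUM theorem-candidate `NetFlux.UnimodalScalarLiouvilleTypeI` (the wall restricted to Type-I-in-time profiles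
AND saddle-free spheres) from five registered stubs (+ NF-0, NF-2 and NF-3ᵛ, landed theorems used BY NAME, and NF-5, proved in this
file).  It does NOT conclude the crux `PoloidalLiouville`, nor the Type-I sub-crux C⁻ = `FarPastCollapse.PoloidalLiouvilleTypeI`,
nor the wall stub: this is a RUNG file (V8 verdict ns-wall-crit-1 g0, 2026-08-28T18:21Z: "W1 movement 0; live theorem-candidate on
the saddle-free Type-I stratum").  `poloidalLiouvilleTypeI_of_line` records exactly what is still missing for C⁻: the typed residual
`MultiHillScalarLiouvilleTypeI` and the four v2 companion stubs.  Navier–Stokes regularity is NOT proved; the crux, C⁻, the wall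
stub and the rung target are all OPEN.

**v6 (planner ns-idea-14 g4, KEY-NS #158 (5); statements UNCHANGED, sorries 5 → 4).**  NF-1bᵛ `stub_envelopeFacts` is now
CLOSED BY NAME: `Theorems.PoloidalLiouville.NetFlux.envelopeFacts` (p667268, ns-qj-p1 g4, `Theorems/UnthreadedDoorNetFluxEnvelopeFacts.lean`,
statement = the verbatim body of `EnvelopeFacts` below over the `rfl`-twinned objects of §4; ns-wall-crit-1 TEXT ✓ 20:58Z).  The three
W1 by-name landings of KEY-NS #158 (5) enter as follows: p667268 closes NF-1bᵛ (here); p666715 `NetFlux.touching_oneSided_of_jointLocalMax`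
and its one-sided twins p667323 `NetFlux.touching_rightDeriv_le_of_jointLocalMax` / `…leftDeriv…` (ARM A ns-exp-scalarLiouville g3) are the
CONTACT LEMMAS of step (WD)(ρ) inside NF-4ᵛ — the right-derivative form is the one (WD) needs, because (L) charges `ℓp` at the outer end
and the symmetric second differences only give `(ℓp+ℓm)/2 ≤ ℓp` (ARM A 20:55:35Z note, agreed); p666373 `HorizonTower.horizonProfileStructure`
belongs to ns-idea-15's horizon-tower line, not to this file.  REMAINING REGISTERED STUBS (4): NF-1a `stub_extremalHeadEMF` (M, the research
stub; planned in `Lines/netflux_typei_gap_nf1a_toolkit.lean` d9acefb9e49a = six typed sub-stubs + proved `NF1a.core_of_levelLipschitz`, memo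
`Lines/netflux_typei_gap_nf1a_plan.md`), NF-1cᵛ `stub_oneSidedLaw_of_hinges` (M; ns-qj-p1 after NF-6), NF-6 `stub_nearCentreFlux` (S; ns-qj-p1 g4,
part 1 `Theorems/UnthreadedDoorNetFluxNearCentreComparison.lean` in tree), NF-4ᵛ `stub_windowDecay_viscosity` (M; ARM A building:
`Theorems/UnthreadedDoorNetFluxViscosityDefs.lean` = Theorems-side twins of (L)/(NC), `…WindowPrimitive.lean` = (WD)(1),(2) for an abstract
density; then NF-3ᵛ p663208 by name).  When NF-6 / NF-4ᵛ / NF-1cᵛ land under `Theorems.PoloidalLiouville.NetFlux.*` with these exact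
statement bodies, each closes here by one `exact` line exactly as NF-1bᵛ does (v7+).  Nothing else changed: v5's composition, BC7 3/3 CLEAN
and the §4 guards stand.  NS regularity NOT proved; `PoloidalLiouville`, C⁻, the wall stub and the rung target stay OPEN.

**v10 (ns-idea-14 g5, 2026-08-28T22:58Z): NF-1a `stub_extremalHeadEMF` CLOSED BY NAME — ALL FIVE v5 STUBS ARE NOW LANDED THEOREMS; sorries 1 → 0.** := `Theorems.PoloidalLiouville.NetFlux.extremalHeadEMF` (p675379 ACCEPTED, commit c273273630e3, ARM A ns-exp-scalarLiouville g4, `Theorems/UnthreadedDoorNetFluxExtremalHeadEMF.lean`, 331 l., 0 sorry, std axioms; chain: `…LevelLipschitz` (the one place unimodality is consumed: level-Lipschitz of the head on saddle-free spheres by a two-sided max-principle), `…ExtremalHeadCore/Deriv/Continuity`, `…EnvelopeToolkit/Regularity`, `…NearCentreComparison`, Literature `SphereUnicoherence`; ns-qj-p1 g5's (Δ)-files `NF1aDeltaSlice/Continuity/Danskin` and (An3) `lastCrossing` p672969 serve the slice-Lipschitz generalisation).  Statement = the verbatim `ExtremalHeadEMF` body over the §4 `rfl`-twins (guard `ExtremalHeadEMF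 ↔ NetFlux.ExtremalHeadEMF := Iff.rfl`), so the constant elaborates against the line's own Prop.  CONSEQUENCE (honest reading): `unimodalScalarLiouvilleTypeI_of_stubs : UnimodalScalarLiouvilleTypeI` is now SORRY-FREE — the RUNG «Type-I-in-time, saddle-free-sphere scalar Liouville» is a THEOREM assembled here from landed Theorems-side results by name (NF-0 p660776 · NF-1a p675379 · NF-1bᵛ p667268 · NF-1cᵛ p673578 · NF-2 p660105 · NF-3ᵛ p663208 · NF-4ᵛ p669139 · NF-5 in-file · NF-6 p668552).  The Theorems-side twin of the rung is ALSO landed by name: `Theorems.PoloidalLiouville.NetFlux.unimodalScalarLiouvilleTypeI_holds` (p675773 ACCEPTED, ARM A g4, `Theorems/UnthreadedDoorNetFluxUnimodalScalarLiouville.lean`, the same composition over the Theorems twins; guard below).  This is MOVEMENT ON THE STRATUM ONLY: the crux `PoloidalLiouville` (1222), C⁻ = `FarPastCollapse.PoloidalLiouvilleTypeI`, and the wall stub `stub_scalarLiouville` remain OPEN — `poloidalLiouvilleTypeI_of_line` still needs the typed residual `MultiHillScalarLiouvilleTypeI` (now split further by the crux idea «height-head» v1.1, `Ideas/height-head.md`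 29a1dd718fc7 / `HeightHeadSketch.lean` v3 ea0844a89f74: dense-Morse stratum K3ᴰ via the slice level-Lipschitz lemma K1 `LevelLipschitzOfAnalyticMorse` for ANALYTIC data + residual `NonDenseMorseResidualTypeI`; critic V18 PASS-WITH-PRICE, graded new-combination) and two of the four v2 companion stubs.  No statement of this file changed since v5 (bcd4955f0879); this version adds one import, one term, one guard example.  NS regularity is NOT proved; no summit is proved by any line.

**v9 (ns-idea-14 g5, 2026-08-28T22:27Z): NF-1cᵛ `stub_oneSidedLaw_of_hinges` CLOSED BY NAME** := `Theorems.PoloidalLiouville.NetFlux.oneSidedNetFluxLaw_of_hinges` (p673578, ns-qj-p1 g5, `Theorems/UnthreadedDoorNetFluxOneSidedLaw.lean` (chain p672773 · p673116 Calculus/Pointwise); statement = `<verbatim EnvelopeFacts body> → ExtremalHeadEMF → OneSidedNetFluxLaw` over the §4 `rfl`/`Iff.rfl`-twins, so the term elaborates against the line's own Props; derivation (L): extremiser comparison in time + the exact slice identity at spherical critical points (`CapSym.headPotentialExists`) + `Δ_S T ≤ 0` at a max + (E)(c) second differences + the head ends from hinge (a) + `k ↓ 0`).  Sorry count 2 →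 1 = {NF-1a `stub_extremalHeadEMF`} (ARM A ns-exp-scalarLiouville g4 F1–F7 + ns-qj-p1 g5 (An3)/(Δ) helpers under `NetFlux.NF1a.*`, KEY-NS #164; target BY NAME `Theorems.PoloidalLiouville.NetFlux.extremalHeadEMF : ExtremalHeadEMF` ⇒ v10 closes it by one line).  No statement changed since v5 (bcd4955f0879); §4 guards + one new by-name example.  Round-5 ideation (lens strengthen): residue `Cruxes/PoloidalLiouville/ExchangeSourceNote.md` (aa4472dec2bb: net exchange source of the multi-hill law = Bernoulli jump [𝒬]_j — bounded saddle count is NOT a closing stratum; Reeb-functional no-go) and ONE candidate crux idea under C0 at v9 time, «height-head»: for ANALYTIC data the loop law `det(y, ∇m, ∇T) = 0` (radial component of (E1)) forces `m|_{S_r} = g_r ∘ T|_{S_r}` with ONE analytic `g_r` across every non-degenerate saddle (jet lemma `(X∂_X − Y∂_Y)m = 0 ⇒ m = g(XY)` + identity theorem along the Reeb tree), hence `Π|_{S_r} = G_r ∘ T` (head = height function), `[Π]_j = 0` at every exchange and `|I| ≤ V·w` with no mountain-pass factor — i.e. hinge (a)'s conclusions on the larger stratum «isolated non-degenerate vorticity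 zeros on a.e. sphere» (NS data are analytic: Lemarié-Rieusset 2016 Thm 9.12); if it survives the critic it becomes a v10+ stratum via NEW Props (v5 bodies untouched).  Honest reading: the rung `UnimodalScalarLiouvilleTypeI` is ONE M-stub away (NF-1a, the EMF/level-set facts at spherical extrema); the wall statement 1222 is untouched.  NS regularity NOT proved; `PoloidalLiouville`, C⁻, the wall stub and the rung target stay OPEN.

**v8 (ns-idea-14 g4, 2026-08-28T21:50Z): NF-4ᵛ `stub_windowDecay_viscosity` CLOSED BY NAME** :=
`fun hL hO hNC => Theorems.PoloidalLiouville.NetFlux.netFluxWindowDecay_of_laws hL hO hNC` (p669139, ARM A ns-exp-scalarLiouville g3;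
chain p666715/p667323 Touching · p668007 WindowPrimitive · p668673 ViscosityStep · p663208 NF-3ᵛ by name, `c = (π/2)C₁`; Theorems-side twins
p660450/p667720 defeq to the line's Props — the term elaborates against the line's own statement, rc 0).  **v7 (21:30Z): NF-6
`stub_nearCentreFlux` CLOSED BY NAME** := `Theorems.PoloidalLiouville.NetFlux.nearCentreFlux` (p668552, ns-qj-p1 g4; crit-1 ✓ FINAL 21:15:30Z).
Sorry count 4 → 2 = exactly the REMAINING REGISTERED STUBS {NF-1a `stub_extremalHeadEMF` (M, the research stub — the two hinge facts
`(d/dt)_{a.e.} Π(x^±)·… `; toolkit d9acefb9e49a with six typed sub-stubs + proved `NF1a.core_of_levelLipschitz`; unclaimed), NF-1cᵛ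
`stub_oneSidedLaw_of_hinges` (M, THE NS lemma `EnvelopeFacts → ExtremalHeadEMF → OneSidedNetFluxLaw`; ns-qj-p1 g4 next, support bricks
p669436 `…SecondDifferenceIntegral` + p669437 `…SphericalExtremumLaplacian` landed 21:22Z)}.  BY NAME NOW: NF-0 p660776 · NF-1bᵛ p667268 ·
NF-2 p660105 · NF-3ᵛ p663208 · NF-4ᵛ p669139 · NF-5 in-file · NF-6 p668552 · (S⁺ ⇒ target) p660934.  No statement changed since v5; V14
BC7/BC2/§4 stand.  Round-4 ideation outcome (multi-hill residual, lens strengthen): found-nothing on a card; tooling/obstruction note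
`Cruxes/PoloidalLiouville/BallFluxDualityNote.md` (v2 d00a1dd85bed).  Honest reading: the rung `UnimodalScalarLiouvilleTypeI` is now TWO
M-stubs away (NF-1a, NF-1cᵛ), both about the NS head/EMF at spherical extrema; the wall statement 1222 is untouched.  NS regularity NOT
proved; `PoloidalLiouville`, C⁻, the wall stub and the rung target stay OPEN.

**v5 = the line owner's ruling on KEY-NS #157 (director-ns g16, 20:03Z: «netflux interface fork — viscosity vs distributional»):
VISCOSITY.**  v4 typed the transport law for the net flux as a DISTRIBUTIONAL subsolution (`NetFluxSubsolution`, fed by the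
Danskin/touching envelope law `SupEnvelopeLaw`) and then had to feed the CLASSICAL comparison NF-3 `HalfLineOU.halfLineOU_decay`
(`C²`, no source): the passage 𝒟′ → classical (mollification at `ρ = 0` does not commute with the `V·|ψ_r|` term; else a weak
comparison on boxes) made NF-4 L/XL (ns-exp-scalarLiouville g3 19:55Z; director #157).  The experiment cell has LANDED the
viscosity twin `HalfLineOU.halfLineOU_decay_viscosity` (p663208: the same decay for a merely CONTINUOUS `U` that satisfies the OU
inequality in the touching-from-above sense).  v5 is the NS-side half of THAT interface and deletes the distributional objects from
the line (`supEnvDefect`, `SupEnvelopeLaw`, `stub_supEnvelopeLaw`, `stub_netFluxSubsolution_of_hinges`, `stub_windowDecay_of_laws`;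
they survive in git history — v4 = crux-write e513ab551935 — and in the Theorems twin `UnthreadedDoorNetFluxEnvelopeDefs`, as the
documented FALLBACK; `NetFluxSubsolution` / `HalfLineOUDecay` stay in the byte-stable sketch, unused by v5's composition).
The v5 law is ONE-SIDED and pointwise (`OneSidedNetFluxLaw`): for `0 < a < R`, with `w = netFlux`, `W_a(t,R) = ∫_a^R w(t,·)`,
  `limsup_{h↓0} [W_a(t,R) − W_a(t−h,R)]/h ≤ ∂⁺w(t,R) − ∂⁻w(t,a) + V(t)·(w(t,R) + w(t,a))`      (typed ε-δ),
legitimate because `r ↦ r·max_{S_r}T` is SEMICONVEX and `r ↦ r·min_{S_r}T` semiconcave (sup / inf of a uniformly `C²` family), so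
`w` has one-sided `r`-derivatives everywhere with `∂⁻w ≤ ∂⁺w`.  THE POINT (it answers the cell's caveat that `U = ∫₀^ρ w` is not a
sup-envelope carrying second-order information): a test function `φ ≥ U` touching at `(s₀,ρ₀)` controls exactly `φ_ρ = U_ρ` and
`φ_ρρ ≥ ∂⁺_ρU_ρ` (RIGHT derivative, by monotonicity of `(U − φ)_ρ` to the right of `ρ₀`) — and the right derivative is all the
law needs, because the symmetric second differences of `w` produce the AVERAGE `(∂⁺w + ∂⁻w)/2 ≤ ∂⁺w`.  No distributions, no
mollifiers, no measurable selections, no Danskin-a.e., no Alexandrov.  Hinge (a) `ExtremalHeadEMF` (NF-1a) is UNCHANGED.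

**Stubs (v6: four open — NF-1a, NF-1cᵛ, NF-6, NF-4ᵛ; prover order NF-6 → NF-4ᵛ ∥ NF-1cᵛ → NF-1a).**  BY NAME (not stubs): NF-1bᵛ `EnvelopeFacts` ←
`Theorems.PoloidalLiouville.NetFlux.envelopeFacts` (p667268, v6); NF-0 `OscLeVorticity` ←
`Theorems.PoloidalLiouville.NetFlux.oscLeVorticity` (KEY-NS #153 (d)); NF-2 `TypeIVorticityBound` ← `…typeIVorticityBound`
(p660105); NF-3ᵛ ← `Literature.Analysis.FluidPDE.HalfLineOU.halfLineOU_decay_viscosity` (p663208; applied inside NF-4ᵛ's proof, its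
statement is not a sketch Prop); NF-5 `RadialOfNetFluxLeZero` PROVED in §1b.
* `stub_extremalHeadEMF`       NF-1a (M, hardest)  hinge (a): extremal head values, EMF bound `|I| ≤ V·netFlux`, Lipschitz, a.e. slope bound.
* `stub_envelopeFacts`         NF-1bᵛ — CLOSED BY NAME in v6 (p667268); kept as a theorem so the composition's argument list is stable: joint continuity of `sphSup/sphInf` in `(t,r)`, one-sided `r`-derivatives of
                               `r·sphSup` / `r·sphInf` with the semiconvex (resp. semiconcave) ordering, uniform touching bound for second
                               differences at every extremiser (pure analysis; cf. qj-p1's landed toolkit `continuousOn_sphSup_family`,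
                               `exists_convexOn_rsphSup_add_sq`, `rsphSup_eq_slice_of_mem_sphArgmax`).
* `stub_oneSidedLaw_of_hinges` NF-1cᵛ (M)  `EnvelopeFacts → ExtremalHeadEMF → OneSidedNetFluxLaw` (slice identity at spherical extrema via
                               `CapSym.headPotentialExists`, `Δ_S T ≤ 0` at a max, second differences, EMF ends; derivation below).
* `stub_nearCentreFlux`        NF-6 (S)  `NearCentreFlux`: `w(t,a) ≤ κa²`, `Lip_r w(t,·)|(0,a₀) ≤ κa₀`, `|w(t,a) − w(t',a)| ≤ κa²|t−t'|`
                               (ω smooth, `ω(x₀) = 0`; cf. qj-p1's growth cap).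
* `stub_windowDecay_viscosity` NF-4ᵛ (M)  `OneSidedNetFluxLaw → OscLeVorticity → NearCentreFlux → NetFluxWindowDecay`: similarity variables,
                               the viscosity inequality for `U` by three one-sided calculus steps, then NF-3ᵛ BY NAME (derivation below).
PROVED here (no sorry): `nf5_radial_of_netFluxLeZero`, `liouville_of_windowDecay` (S⁺ + NF-2 + NF-5 ⇒ target: the ancient limit
`t₁ → −∞`), the composition, the C⁻ bookkeeping, and `lineComposition_of` (g2's `LineComposition` modulo the v4 distributional NF-4 —
fallback bookkeeping only).
§4 ANTI-DRIFT GUARD (V12 P4): `Iff.rfl` / `rfl` twins against `Theorems/UnthreadedDoorNetFluxDefs.lean` (14, p660450) AND, new in v5,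
against qj-p1's `Theorems/UnthreadedDoorNetFluxEnvelopeDefs.lean` (p662148: `sphArgmax`, `sphArgmin`, `radDeriv`, `radDeriv2`,
`ExtremalHeadEMF`, `RadialOfNetFluxLeZero`), so an edit of either copy breaks THIS file's check instead of silently breaking by-name closure.

## Derivation of (L) (for the prover of `stub_oneSidedLaw_of_hinges`; all suprema are over compact sets away from `x₀`)
Fix `t`, `0 < a < R`, small `h > 0`; `x̂⁺ ∈ argmax_{S_r}T(t)`, `x̂⁻ ∈ argmin` (ANY choice, time `t`).  Since
`sphSup(t−h) ≥ T(t−h,x̂⁺)` and `sphInf(t−h) ≤ T(t−h,x̂⁻)`: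
  `w(t,r) − w(t−h,r) ≤ r{[T(t,x̂⁺) − T(t−h,x̂⁺)] − [T(t,x̂⁻) − T(t−h,x̂⁻)]} ≤ h·r[T_t(t,x̂⁺) − T_t(t,x̂⁻)] + R M₂ h²`
(Taylor in `t`, `M₂ = sup |T_tt|` on `[t−δ₀,t] × {a ≤ |x−x₀| ≤ R}`).  SLICE INEQUALITY at spherical extrema: with the head
`P(t,·)` of `Theorems.PoloidalLiouville.CapSym.headPotentialExists` (from `CurledLaw`; the radial component of
`L·(x−x₀) = m∇T − ∇P` reads `T_t + ⟪v,∇T⟫ − ΔT = v_r T_r − P_r/r`), at a critical point of `T|_{S_r}` one has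
`⟪v,∇T⟫ = v_r T_r`, hence `T_t = ΔT − P_r/r` EXACTLY, and `ΔT = T_rr + (2/r)T_r + r⁻²Δ_S T` with `Δ_S T ≤ 0` at a max
(`≥ 0` at a min; Hessian along two great circles, `InnerProductSpace.laplacian_eq_iteratedFDeriv_orthonormalBasis`).  So
  `r[T_t(x̂⁺) − T_t(x̂⁻)] ≤ [(f_σ̂⁺)''(r) − (f_σ̂⁻)''(r)] − [P_r(x̂⁺) − P_r(x̂⁻)]`,  `f_σ(ρ) = ρ T(t, x₀ + ρσ)`, `(f_σ̂)'' = r·radDeriv2 + 2·radDeriv`.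
By (E)(c): `(f_σ̂⁺)'' − (f_σ̂⁻)'' ≤ Δ²_k w(r)/k² + 2Mk` (`Δ²_k` = symmetric second difference, `w = F⁺ − F⁻`).  Choosing `x̂⁺` to
MAXIMISE `P_r` over `argmax` and `x̂⁻` to minimise over `argmin` (compact sets, `P ∈ C¹` off `x₀`), (A)(v) gives
`−[P_r(x̂⁺) − P_r(x̂⁻)] ≤ −∂_r I(t,r)` for a.e. `r`.  Integrate over `[a,R]` (`I(t,·)` Lipschitz ⇒ `∫_a^R ∂_rI = I(R) − I(a)`; (A)(iv):
`|I| ≤ V w`):  `[W_a(t,R) − W_a(t−h,R)]/h ≤ [D_k(R) − D_k(a)]/k² + 2Mk(R−a) + V(w(R) + w(a)) + RM₂(R−a)h`, where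
`D_k(r) = ∫_r^{r+k} w − ∫_{r−k}^{r} w` (exact identity `∫_a^R Δ²_k w = D_k(R) − D_k(a)` for continuous `w`).  As `k ↓ 0` (h FIXED):
`D_k(r)/k² → (∂⁺w(r) + ∂⁻w(r))/2`, and `w = F⁺ − F⁻` is SEMICONVEX ((E)(b)), so `(∂⁺w+∂⁻w)(R)/2 ≤ ∂⁺w(R)` and
`−(∂⁺w+∂⁻w)(a)/2 ≤ −∂⁻w(a)`.  Choosing `δ` with `RM₂(R−a)δ ≤ ε` gives (L).  (`a > 0` keeps every constant on compacts off `x₀`, so no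
gauge / boundedness of `T` at the centre is needed at this stage.)

## Derivation of (WD) (for the prover of `stub_windowDecay_viscosity`)
Data of `NetFluxWindowDecay`: window `(t₀,0)`, `‖v‖ ≤ C/√(−t)` (so `V(t) = C/√(−t)`), `‖ω‖ ≤ C₁/(−t)`, ω-link, `CurledLaw`, unimodal;
fix `t₁ ∈ (t₀,0)`, `s₁ = −log(−t₁)`, `t(s) = −e^{−s}`, `U(s,ρ) := W(t(s), ρ√(−t(s)))`, `W(t,R) = ∫_{(0,R)} w(t,r) dr`.
(1) A-priori (NF-0 by name + the vorticity bound): `w(t,r) ≤ πC₁ r/(−t)`, so `0 ≤ U ≤ (π/2)C₁ρ² ≤ c(1+ρ)³`, `c = (π/2)C₁ ≥ 0`; `U(s,0) = 0`.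
(2) Continuity of `U` on `[s₁,∞) × [0,∞)`: `w` is jointly continuous on the window × `(0,∞)` ((L), first conjunct) and `≤ πC₁r/(−t)` near
    `r = 0`, so `W` is jointly continuous on the window × `[0,∞)`; compose with `(s,ρ) ↦ (t(s), ρ√(−t(s)))`.
(3) VISCOSITY INEQUALITY at a joint local max `(s₀,ρ₀)` of `U − φ` (`s₀ > s₁`, `ρ₀ > 0`; `t₀ = t(s₀)`, `R₀ = ρ₀√(−t₀)`), worked IN `(s,ρ)`
    (the test class is only separately differentiable, so do NOT change variables in `φ`):
    (ρ) `U(s₀,·) = W(t₀, ·√(−t₀))` is differentiable with derivative `u(ρ) = √(−t₀)·w(t₀,ρ√(−t₀))`, which has right derivative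
        `(−t₀)·ℓp(t₀,R₀)` at `ρ₀`.  Local max in `ρ` ⇒ Fermat `u(ρ₀) = φ₁(ρ₀)`, i.e. `w(t₀,R₀) = φ₁(ρ₀)/√(−t₀)`; and
        `(−t₀)ℓp(t₀,R₀) ≤ φ₂(ρ₀)` (else `(U − φ)_ρ = u − φ₁` vanishes at `ρ₀` with positive right derivative, so `U − φ` increases just
        right of `ρ₀` — contradiction).
    (s)  For small `σ > 0`, with `h = t₀ − t(s₀−σ) > 0`, `k = ρ₀√(−t(s₀−σ)) − R₀ > 0`:
        `U(s₀,ρ₀) − U(s₀−σ,ρ₀) = [W(t₀,R₀) − W(t₀−h,R₀)] − ∫_{R₀}^{R₀+k} w(t₀−h,r) dr`.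
        First bracket: split `W = W_a + ∫₀^a w`; (L) bounds `[W_a(t₀,R₀) − W_a(t₀−h,R₀)]/h` by `ℓp(t₀,R₀) − ℓm(t₀,a) + V(w(R₀)+w(a)) + ε`
        for `h < δ(a,ε)`, and (NC) bounds `(1/h)∫₀^a |w(t₀,r) − w(t₀−h,r)| dr ≤ κa³/3`, `|ℓm(t₀,a)| ≤ κa₀`, `w(t₀,a) ≤ κa²`; so for every
        `η > 0` (choose `a`, then `ε`, then `δ`):  `[W(t₀,R₀) − W(t₀−h,R₀)]/h ≤ ℓp(t₀,R₀) + V(t₀)w(t₀,R₀) + η` for all small `h`.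
        Second term: `(1/σ)∫_{R₀}^{R₀+k} w(t₀−h,·) → (R₀/2)·w(t₀,R₀)` (joint continuity; `k/σ → R₀/2`, `h/σ → (−t₀)`).
        Local max in `s` from the past ⇒ `φₛ ≤ liminf_σ [U(s₀,ρ₀) − U(s₀−σ,ρ₀)]/σ ≤ (−t₀)[ℓp + V w](t₀,R₀) − (R₀/2)w(t₀,R₀)`.
    (=)  Combine with (ρ): `(−t₀)ℓp ≤ φ₂(ρ₀)`, `(−t₀)V w = Cφ₁(ρ₀)`, `(R₀/2)w = (ρ₀/2)φ₁(ρ₀)`:  `φₛ ≤ φ₂(ρ₀) + (C − ρ₀/2)φ₁(ρ₀)`. ∎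
(4) `HalfLineOU.halfLineOU_decay_viscosity C` (λ, A depend on `C` only) ⇒ `U ≤ A c (1+ρ)³ e^{−λ(s−s₁)}`, and `e^{−λ(s−s₁)} = (t/t₁)^λ`:
    `∫₀ᴿ netFlux(T t) ≤ (Aπ/2)·C₁·(1 + R/√(−t))³ (t/t₁)^λ` — `NetFluxWindowDecay` with `lam = λ(C)`, `A' = Aπ/2`.
GAUGE NOTE (for (NC) and for provers who want sup-norm control near `x₀`): `CurledLaw`, the ω-link, unimodality and `netFlux` are invariant
under `T ↦ T + g(t,|x−x₀|)` (`L` gains `g_t + v_r g' − Δg`; both sides of `CurledLaw` gain `g'∇v_r × (x−x₀)`), so one may normalise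
`T(t, x₀ + r e) = 0` along a reference ray; then `|T|, |T_t| ≤ π r sup_{S_r}(‖ω‖, ‖ω_t‖) = O(r²)` near the centre.


Navier–Stokes regularity is NOT proved; crux 1222 is OPEN; this file is a RUNG skeleton (evidence on the crux item, not a route).
-/
noncomputable section

open Set Function Filter Topology MeasureTheory
open scoped RealInnerProductSpace

set_option linter.dupNamespace false

namespace Summit.NavierStokesRegularity.NavierStokesRegularity.Cruxes.PoloidalLiouville.NetFlux

open Summit.NavierStokesRegularity.NavierStokesRegularity.Cruxes.PoloidalLiouville
open Literature.Analysis.FluidPDE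

/-! ### §0 Typed objects (V8 P1 / P3; v5 keeps `sphArgmax`, `sphArgmin`, `radDeriv`, `radDeriv2`, `ExtremalHeadEMF`, `RadialOfNetFluxLeZero`) -/

/-- `argmax_{S_r(x₀)} f` (nonempty compact for `r > 0`, `f` continuous on the sphere). -/
def sphArgmax (f : E3 → ℝ) (x₀ : E3) (r : ℝ) : Set E3 :=
  {x : E3 | x ∈ Metric.sphere x₀ r ∧ ∀ y ∈ Metric.sphere x₀ r, f y ≤ f x}

/-- `argmin_{S_r(x₀)} f`. -/
def sphArgmin (f : E3 → ℝ) (x₀ : E3) (r : ℝ) : Set E3 :=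
  {x : E3 | x ∈ Metric.sphere x₀ r ∧ ∀ y ∈ Metric.sphere x₀ r, f x ≤ f y}

/-- Radial derivative `∂_r f (x)` (`x ≠ x₀`, along the unit vector `(x − x₀)/‖x − x₀‖`). -/
def radDeriv (f : E3 → ℝ) (x₀ x : E3) : ℝ :=
  deriv (fun ρ : ℝ => f (x₀ + ρ • (‖x - x₀‖⁻¹ • (x - x₀)))) ‖x - x₀‖

/-- Second radial derivative `∂_r² f (x)`. -/
def radDeriv2 (f : E3 → ℝ) (x₀ x : E3) : ℝ :=
  iteratedDeriv 2 (fun ρ : ℝ => f (x₀ + ρ • (‖x - x₀‖⁻¹ • (x - x₀)))) ‖x - x₀‖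

/-- **(NF-1a, V8 P1 hinge (a), M) Extremal head values and the EMF bound on saddle-free spheres.**
Data: `v, T` smooth on a window (`T` off the centre), a `C¹` head `P(t,·)` off `x₀` with TANGENTIAL relation
`∇P − m ∇T ∥ (x − x₀)`, `m = ⟪v, x − x₀⟫` (this is what `Theorems.PoloidalLiouville.CapSym.headPotentialExists`
delivers from (E1)), `‖v(t,·)‖ ≤ V(t)`, every sphere saddle-free (`IsUnimodalSphere`).  THEN the extremal head
difference `I(t,r) := P(t,x⁺) − P(t,x⁻)` is (i) independent of the choice of `x⁺ ∈ argmax_{S_r} T(t)`,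
`x⁻ ∈ argmin`, (ii) jointly continuous, (iii) locally Lipschitz in `r > 0`, (iv) `|I| ≤ V · r · osc = V · netFlux`,
(v) for a.e. `r`, `∂_r I ≤ sup_{argmax} ∂_r P − inf_{argmin} ∂_r P`.
PROOF ROUTE (planner g3; `P ∈ C¹` suffices — no Sard for `P`, no monotone paths, no Whitney pathology):
(α) existence of `P` with `∇_S P = m ∇_S T` forces `∇_S m ∥ ∇_S T`, so `m` is CONSTANT (`=: m̄(c)`) on every
regular level curve of `T|_{S_r}`, and `P` is constant there too; (β) on a saddle-free sphere every regular level
set `{T = c}` is ONE circle separating `{T > c}` from `{T < c}` (two circles would disconnect a sub- or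
super-level set); (γ) for ANY `C¹` path `γ` on `S_r`, `P(γ(1)) − P(γ(0)) = ∫_γ m dT = ∫ m̄(c) · ι(γ,c) dc`
(1-D area formula in `c`; Sard for the smooth `T|_{S_r}`; `ι` = algebraic crossing number of `γ` with the
circle `{T = c}`), and `ι = 1` for `T⁻ < c < T⁺` when `γ` runs from `argmin` to `argmax`, `ι = 0` when both
ends are maximisers.  Hence (i) and `I = ∫_{T⁻}^{T⁺} m̄(c) dc`, so (iv) from `|m̄| ≤ rV`; (ii) by dominated
convergence (`m̄(t,r,c)` is continuous at regular `(t,r,c)`, bounded); (iii) and (v) by comparing spheres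
`r, r'` along radially scaled paths: the end corrections are `∫_{T(r',x₀+r'ξ^±)}^{T^±(r')} m̄`, of size
`≤ r'V · |T^±(r') − T(r', x₀ + r'ξ^±(r))| = O(|r'−r|)` (Lipschitz) and `= o(|r'−r|)` at Danskin points of `T^±`
(where `∂_r T^± = ∂_r T(x^±)` for every extremiser), which gives `∂_r I = ∂_r P(x⁺) − ∂_r P(x⁻)` for EVERY
choice, a.e.  This is where «max-exchange» pathologies are shown ABSENT under unimodality. -/
def ExtremalHeadEMF : Prop :=
  ∀ (v : ℝ → E3 → E3) (x₀ : E3) (T P : ℝ → E3 → ℝ) (V : ℝ → ℝ) (t₀ : ℝ),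
    ContDiffOn ℝ (⊤ : ℕ∞) (uncurry v) (Ioo t₀ 0 ×ˢ univ) →
    ContDiffOn ℝ (⊤ : ℕ∞) (uncurry T) (Ioo t₀ 0 ×ˢ ({x₀}ᶜ : Set E3)) →
    (∀ t ∈ Ioo t₀ 0, ContDiffOn ℝ 1 (P t) ({x₀}ᶜ : Set E3)) →
    (∀ t ∈ Ioo t₀ 0, ∀ x, ‖v t x‖ ≤ V t) →
    (∀ t ∈ Ioo t₀ 0, ∀ x, x ≠ x₀ →
        cross (gradient (P t) x - (inner ℝ (v t x) (x - x₀)) • gradient (T t) x) (x - x₀) = 0) →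
    (∀ t ∈ Ioo t₀ 0, ∀ r > 0, IsUnimodalSphere (T t) x₀ r) →
    ∃ I : ℝ → ℝ → ℝ,
      (∀ t ∈ Ioo t₀ 0, ∀ r > 0, ∀ xp ∈ sphArgmax (T t) x₀ r, ∀ xm ∈ sphArgmin (T t) x₀ r,
          I t r = P t xp - P t xm) ∧
      ContinuousOn (uncurry I) (Ioo t₀ 0 ×ˢ Ioi 0) ∧
      (∀ t ∈ Ioo t₀ 0, ∀ a b : ℝ, 0 < a → a < b → ∃ L : NNReal, LipschitzOnWith L (I t) (Icc a b)) ∧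
      (∀ t ∈ Ioo t₀ 0, ∀ r > 0, |I t r| ≤ V t * netFlux (T t) x₀ r) ∧
      (∀ t ∈ Ioo t₀ 0, ∀ᵐ r : ℝ, 0 < r →
          deriv (I t) r ≤ sSup (radDeriv (P t) x₀ '' sphArgmax (T t) x₀ r)
                          - sInf (radDeriv (P t) x₀ '' sphArgmin (T t) x₀ r))

/-- **(NF-5, V8 P3's two S-lemmas merged, S) Vanishing cumulative net flux forces a radial potential.**
For `T ∈ C¹(ℝ³ ∖ {x₀})` bounded: `r ↦ osc_{S_r} T` is continuous on `r > 0` (compact spheres), `netFlux ≥ 0`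
is bounded on `(0,R)`, so `∫₀ᴿ netFlux ≤ 0` for all `R` forces `osc_{S_r} T = 0` for every `r > 0`, i.e. `T`
is constant on spheres, i.e. `∇T ∥ (x − x₀)`.  (Boundedness of `T` is needed: for `T = g(ξ)/r²` the integral
is junk-zero.)  At `x = x₀` the conclusion is `cross _ 0 = 0`. -/
def RadialOfNetFluxLeZero : Prop :=
  ∀ (T : E3 → ℝ) (x₀ : E3), ContDiffOn ℝ 1 T ({x₀}ᶜ : Set E3) → (∃ C : ℝ, ∀ x, |T x| ≤ C) →
    (∀ R > 0, ∫ r in Ioo 0 R, netFlux T x₀ r ≤ 0) → ∀ x, cross (gradient T x) (x - x₀) = 0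

/-! ### §0v The v5 (viscosity-interface) typed objects: (E) `EnvelopeFacts`, (L) `OneSidedNetFluxLaw`, (NC) `NearCentreFlux` -/

/-- **(E, S/M⁻, pure analysis — no PDE) Envelope facts for the spherical max / min of a function smooth off the centre.**
For `T` smooth on `(t₀,0) × (ℝ³ ∖ {x₀})`, with `F⁺(t,ρ) = ρ·sphSup (T t) x₀ ρ`, `F⁻(t,ρ) = ρ·sphInf (T t) x₀ ρ`:
(a) `(t,r) ↦ sphSup`, `sphInf` are jointly continuous on `(t₀,0) × (0,∞)` (compact spheres, parametrise `S_r = x₀ + r·S²`);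
(b) for every `t` and `r > 0`, `F⁺(t,·)` has a right derivative `dp` and a left derivative `dm` at `r` with `dm ≤ dp`, and `F⁻(t,·)` has
    them with `dp ≤ dm` — because on compact `ρ`-intervals `F⁺ = sup_σ f_σ`, `f_σ(ρ) = ρ T(t, x₀ + ρσ)`, `σ ∈ S²`, is a sup of a
    uniformly `C²` family, hence SEMICONVEX (`F⁺ + Kρ²/2` convex), and `F⁻` is semiconcave;
(c) uniform touching bound for second differences: on `r ∈ [a,R] ⊂ (0,∞)`, `0 < k < k₀ < a`, for EVERY maximiser `x ∈ argmax_{S_r}T(t)`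
    (direction `σ̂`), `f_σ̂(r) = F⁺(r)` and `f_σ̂ ≤ F⁺`, so `(f_σ̂)''(r) ≤ Δ²_k F⁺(r)/k² + M k` with `M = sup|f'''|/3` (Taylor), where
    `(f_σ̂)''(r) = r·radDeriv2 + 2·radDeriv` at `x`; reverse inequality at minimisers for `F⁻`.
All three are textbook (Danskin / semiconcave-function calculus); nothing here sees the centre `x₀` or the PDE. -/
def EnvelopeFacts : Prop :=
  ∀ (T : ℝ → E3 → ℝ) (x₀ : E3) (t₀ : ℝ),
    ContDiffOn ℝ (⊤ : ℕ∞) (uncurry T) (Ioo t₀ 0 ×ˢ ({x₀}ᶜ : Set E3)) →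
      ContinuousOn (fun p : ℝ × ℝ => sphSup (T p.1) x₀ p.2) (Ioo t₀ 0 ×ˢ Ioi 0) ∧
      ContinuousOn (fun p : ℝ × ℝ => sphInf (T p.1) x₀ p.2) (Ioo t₀ 0 ×ˢ Ioi 0) ∧
      (∀ t ∈ Ioo t₀ 0, ∀ r > 0, ∃ dp dm : ℝ,
          HasDerivWithinAt (fun ρ => ρ * sphSup (T t) x₀ ρ) dp (Ioi r) r ∧
          HasDerivWithinAt (fun ρ => ρ * sphSup (T t) x₀ ρ) dm (Iio r) r ∧ dm ≤ dp) ∧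
      (∀ t ∈ Ioo t₀ 0, ∀ r > 0, ∃ dp dm : ℝ,
          HasDerivWithinAt (fun ρ => ρ * sphInf (T t) x₀ ρ) dp (Ioi r) r ∧
          HasDerivWithinAt (fun ρ => ρ * sphInf (T t) x₀ ρ) dm (Iio r) r ∧ dp ≤ dm) ∧
      (∀ t ∈ Ioo t₀ 0, ∀ a R : ℝ, 0 < a → a ≤ R → ∃ M k₀ : ℝ, 0 < k₀ ∧ k₀ < a ∧
          ∀ k ∈ Ioo 0 k₀, ∀ r ∈ Icc a R,
            (∀ x ∈ sphArgmax (T t) x₀ r,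
                r * radDeriv2 (T t) x₀ x + 2 * radDeriv (T t) x₀ x
                  ≤ ((r + k) * sphSup (T t) x₀ (r + k) - 2 * (r * sphSup (T t) x₀ r)
                      + (r - k) * sphSup (T t) x₀ (r - k)) / k ^ 2 + M * k) ∧
            (∀ x ∈ sphArgmin (T t) x₀ r,
                ((r + k) * sphInf (T t) x₀ (r + k) - 2 * (r * sphInf (T t) x₀ r)
                    + (r - k) * sphInf (T t) x₀ (r - k)) / k ^ 2 - M * k
                  ≤ r * radDeriv2 (T t) x₀ x + 2 * radDeriv (T t) x₀ x))

/-- **(L, the NS-side law in ONE-SIDED (viscosity-ready) form; replaces v4's distributional `NetFluxSubsolution`.)**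
Same window data as `NetFluxSubsolution` (`v, T` smooth, `T` off the centre; `‖v(t,·)‖ ≤ V(t)`; `CurledLaw`; saddle-free spheres).
THEN `w(t,r) = netFlux (T t) x₀ r` is jointly continuous on `(t₀,0) × (0,∞)`, has right / left `r`-derivatives `ℓp, ℓm` at every
`r > 0`, and for all `0 < a < R` the truncated cumulative flux `W_a(t,R) = ∫_a^R w(t,r) dr` obeys the one-sided law
  `limsup_{h↓0} [W_a(t,R) − W_a(t−h,R)]/h ≤ ℓp(t,R) − ℓm(t,a) + V(t)·(w(t,R) + w(t,a))`
(typed ε-δ).  Informally: `W_t ≤ W_RR + V W_R` tested at single points from the past, with the boundary fluxes at `r = a, R`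
paid by the EMF bound `|I| ≤ V w`.  Derivation in the module docstring (slice inequality at spherical extrema + (E) + (A)).
Test functions never appear; `a > 0` keeps every estimate on compacts away from `x₀` (no boundedness of `T` at the centre is used). -/
def OneSidedNetFluxLaw : Prop :=
  ∀ (v : ℝ → E3 → E3) (x₀ : E3) (T : ℝ → E3 → ℝ) (V : ℝ → ℝ) (t₀ : ℝ),
    ContDiffOn ℝ (⊤ : ℕ∞) (uncurry v) (Ioo t₀ 0 ×ˢ univ) →
    ContDiffOn ℝ (⊤ : ℕ∞) (uncurry T) (Ioo t₀ 0 ×ˢ ({x₀}ᶜ : Set E3)) →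
    (∀ t ∈ Ioo t₀ 0, ∀ x, ‖v t x‖ ≤ V t) →
    CurledLaw v x₀ T (Ioo t₀ 0) →
    (∀ t ∈ Ioo t₀ 0, ∀ r > 0, IsUnimodalSphere (T t) x₀ r) →
    ∃ ℓp ℓm : ℝ → ℝ → ℝ,
      ContinuousOn (fun p : ℝ × ℝ => netFlux (T p.1) x₀ p.2) (Ioo t₀ 0 ×ˢ Ioi 0) ∧
      (∀ t ∈ Ioo t₀ 0, ∀ r > 0, HasDerivWithinAt (fun ρ => netFlux (T t) x₀ ρ) (ℓp t r) (Ioi r) r) ∧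
      (∀ t ∈ Ioo t₀ 0, ∀ r > 0, HasDerivWithinAt (fun ρ => netFlux (T t) x₀ ρ) (ℓm t r) (Iio r) r) ∧
      (∀ t ∈ Ioo t₀ 0, ∀ a R : ℝ, 0 < a → a < R → ∀ ε > 0, ∃ δ > 0, ∀ h ∈ Ioo 0 δ,
          (∫ r in Ioo a R, netFlux (T t) x₀ r) - (∫ r in Ioo a R, netFlux (T (t - h)) x₀ r)
            ≤ h * (ℓp t R - ℓm t a + V t * (netFlux (T t) x₀ R + netFlux (T t) x₀ a) + ε))

/-- **(NC, S, NS kinematics near the centre.)**  For `v` smooth on the window with `curl v = ∇T × (x − x₀)`, `T` smooth off `x₀`: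
`ω(t,x₀) = 0` (the hypothesis at `x = x₀` reads `curl v = cross _ 0 = 0`), so `‖ω‖, ‖ω_t‖ ≤ M‖x − x₀‖` on `[t₁,t₂] × B̄(x₀,1)`;
with `∇_S T = (ŷ × ω)/r` and `∇_S(∂_r T) = r⁻¹ ŷ × (∂_r ω)` one gets (a) `w(t,a) = a·osc_{S_a}T(t) ≤ πM a²`, (b) the a.e. derivative
`∂_a w = osc + a(T_r(x̂⁺) − T_r(x̂⁻))` is `≤ 2πM a` in size, so `w(t,·)` is `2πM a₀`-Lipschitz on `(0,a₀)`, and (c) comparing `T(t,·)`,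
`T(t',·)` after subtracting their values at the reference point `x₀ + a e` of the SAME sphere (osc is shift-invariant):
`|w(t,a) − w(t',a)| ≤ 2π M a²|t − t'|` — all uniformly for `t, t' ∈ [t₁,t₂] ⊂ (t₀,0)`.  Used by (WD) to make the `r = a` terms of (L)
and the `∫₀^a` remainder vanish as `a ↓ 0`. -/
def NearCentreFlux : Prop :=
  ∀ (v : ℝ → E3 → E3) (x₀ : E3) (T : ℝ → E3 → ℝ) (t₀ t₁ t₂ : ℝ), t₀ < t₁ → t₁ ≤ t₂ → t₂ < 0 →
    ContDiffOn ℝ (⊤ : ℕ∞) (uncurry v) (Ioo t₀ 0 ×ˢ univ) →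
    ContDiffOn ℝ (⊤ : ℕ∞) (uncurry T) (Ioo t₀ 0 ×ˢ ({x₀}ᶜ : Set E3)) →
    (∀ t ∈ Ioo t₀ 0, ∀ x, curl (v t) x = cross (gradient (T t) x) (x - x₀)) →
    ∃ κ : ℝ, 0 ≤ κ ∧ ∀ a₀ : ℝ, 0 < a₀ → a₀ ≤ 1 →
      (∀ t ∈ Icc t₁ t₂,
        (∀ a ∈ Ioo 0 a₀, netFlux (T t) x₀ a ≤ κ * a ^ 2) ∧
        LipschitzOnWith (Real.toNNReal (κ * a₀)) (fun r => netFlux (T t) x₀ r) (Ioo 0 a₀)) ∧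
      (∀ t ∈ Icc t₁ t₂, ∀ t' ∈ Icc t₁ t₂, ∀ a ∈ Ioo 0 a₀,
        |netFlux (T t) x₀ a - netFlux (T t') x₀ a| ≤ κ * a ^ 2 * |t - t'|)

/-! ### §1 Registered stubs -/

/-- NF-3ᵛ is LANDED (not a stub; v5): the VISCOSITY half-line Dirichlet–OU decay `HalfLineOU.halfLineOU_decay_viscosity`
(p663208, ns-exp-scalarLiouville g3), applied BY NAME inside NF-4ᵛ's proof — name-resolution check: -/
example (C : ℝ) (hC : 0 ≤ C) := HalfLineOU.halfLineOU_decay_viscosity C hC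

/-- (v4 fallback, orientation only) the classical NF-3 `HalfLineOU.halfLineOU_decay` (p658091) still closes the sketch Prop
`HalfLineOUDecay` by name; v5's composition does not consume it. -/
theorem nf3_halfLineOUDecay : HalfLineOUDecay := HalfLineOU.halfLineOU_decay

/-- The head potential the prover of NF-1cᵛ takes `P` from (landed, ns-idea-11 g2): name resolves. -/
example := @Theorems.PoloidalLiouville.CapSym.headPotentialExists

/-- NF-0 is LANDED (not a stub; line v4): `osc_{S_r} T ≤ π · sup_{S_r} ‖ω‖`, closed BY NAME by
`Theorems.PoloidalLiouville.NetFlux.oscLeVorticity` (KEY-NS #153 (d); great-circle integration, `|∇_S T| = ‖ω‖/r`). -/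
theorem nf0_oscLeVorticity : OscLeVorticity :=
  Theorems.PoloidalLiouville.NetFlux.oscLeVorticity

/-- NF-2 is LANDED (not a stub; line v3): the Type-I vorticity bound, closed BY NAME by
`Theorems.PoloidalLiouville.NetFlux.typeIVorticityBound` (p660105, ns-exp-scalarLiouville g3; by-name check
ns-wall-crit-1 g0 19:13:58Z). -/
theorem nf2_typeIVorticityBound : TypeIVorticityBound :=
  Theorems.PoloidalLiouville.NetFlux.typeIVorticityBound

/-- NF-1a (M, the hardest stub; statement unchanged since v1): V8 P1 hinge (a) — **CLOSED BY NAME (v10):**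
`Theorems.PoloidalLiouville.NetFlux.extremalHeadEMF` (p675379, ARM A ns-exp-scalarLiouville g4). -/
theorem stub_extremalHeadEMF : ExtremalHeadEMF :=
  -- v10: CLOSED BY NAME (p675379) — `ExtremalHeadEMF` unfolds to the landed statement over the `rfl`-twins of §4.
  Theorems.PoloidalLiouville.NetFlux.extremalHeadEMF

/-- NF-1bᵛ (S/M⁻, pure analysis) — v6: no longer a stub, closed by name below.  (a) `continuousOn_sphSup_family`-type continuity; (b) one-sided derivatives from semiconvexity of
`ρ ↦ ρ·sphSup + Kρ²` on compacts (`exists_convexOn_rsphSup_add_sq`, Mathlib `ConvexOn` one-sided derivative API); (c) Taylor with the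
uniform `C³` bound of `(ρ,σ) ↦ ρ T(t, x₀ + ρσ)` on `[a − k₀, R + k₀] × S²` and `F⁺ ≥ f_σ̂`, `F⁺(r) = f_σ̂(r)`. -/
theorem stub_envelopeFacts : EnvelopeFacts :=
  -- v6: CLOSED BY NAME (p667268, ns-qj-p1 g4) — `EnvelopeFacts` unfolds to the landed statement over the `rfl`-twins of §4.
  fun T x₀ t₀ hT => Theorems.PoloidalLiouville.NetFlux.envelopeFacts T x₀ t₀ hT

/-- NF-1cᵛ (M, THE load-bearing NS lemma of v5) — **CLOSED BY NAME (v9):** `Theorems.PoloidalLiouville.NetFlux.oneSidedNetFluxLaw_of_hinges` (p673578, ns-qj-p1 g5). The hinges give the one-sided law; derivation «(L)» in the module docstring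
(extremiser comparison in time, the EXACT slice identity `T_t = ΔT − P_r/r` at critical points of `T|_{S_r}` from
`CapSym.headPotentialExists`, `Δ_S T ≤ 0` at a max, (E)(c) second differences, (A)(iv),(v) for the head ends, `k ↓ 0` by semiconvexity). -/
theorem stub_oneSidedLaw_of_hinges : EnvelopeFacts → ExtremalHeadEMF → OneSidedNetFluxLaw :=
  -- v9: CLOSED BY NAME (p673578, ns-qj-p1 g5) — hypothesis 1 is the verbatim `EnvelopeFacts` body, 2/3 are the §4 twins.
  fun hE hA => Theorems.PoloidalLiouville.NetFlux.oneSidedNetFluxLaw_of_hinges hE hA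

/-- NF-6 (S): near-centre kinematics (`ω(t,x₀) = 0`, mean value on `[t₁,t₂] × B̄(x₀,1)`, great-circle integration as in NF-0).
**CLOSED BY NAME (v7):** `Theorems.PoloidalLiouville.NetFlux.nearCentreFlux` (p668552, ns-qj-p1 g4,
`Theorems/UnthreadedDoorNetFluxNearCentreFlux.lean`; statement = the verbatim body of `NearCentreFlux` over the §4 `rfl`-twins; `κ = π(2L+M)`;
ns-wall-crit-1 ✓ FINAL 21:15:30Z). -/
theorem stub_nearCentreFlux : NearCentreFlux :=
  Theorems.PoloidalLiouville.NetFlux.nearCentreFlux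

/-- NF-4ᵛ (M): change of variables `U(s,ρ) = W(t(s), ρ√(−t(s)))`, a-priori bound (NF-0 + the vorticity bound), continuity, the
viscosity inequality at a joint local max from (L) + (NC) by three one-sided calculus steps (Fermat in `ρ`, right-monotonicity for
`φ_ρρ ≥ (−t)∂⁺w`, past difference quotient in `s`), then `HalfLineOU.halfLineOU_decay_viscosity` BY NAME with `c = (π/2)C₁`;
derivation «(WD)» in the module docstring.
**CLOSED BY NAME (v8):** `Theorems.PoloidalLiouville.NetFlux.netFluxWindowDecay_of_laws` (p669139, ARM A ns-exp-scalarLiouville g3,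
`Theorems/UnthreadedDoorNetFluxWindowDecayViscosity.lean`; chain p666715/p667323 Touching · p668007 WindowPrimitive · p668673 ViscosityStep ·
p663208 `HalfLineOU.halfLineOU_decay_viscosity` with `c = (π/2)C₁`; Theorems-side twins p660450 / p667720 of the four Props, defeq to the line's). -/
theorem stub_windowDecay_viscosity :
    OneSidedNetFluxLaw → OscLeVorticity → NearCentreFlux → NetFluxWindowDecay :=
  fun hL hO hNC => Theorems.PoloidalLiouville.NetFlux.netFluxWindowDecay_of_laws hL hO hNC

/-! ### §1b NF-5 is PROVED here (no stub): V8 P3's S-lemmas -/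

/-- The image of the sphere `S_r(x₀)`, `r > 0`, under `T` is the range of `ξ ↦ T (x₀ + r ξ)` on the unit sphere. -/
lemma nf5_image_sphere_eq (T : E3 → ℝ) (x₀ : E3) {r : ℝ} (hr : 0 < r) :
    T '' Metric.sphere x₀ r =
      (fun ξ : Metric.sphere (0 : E3) 1 => T (x₀ + r • (ξ : E3))) '' univ := by
  ext v
  simp only [mem_image, Metric.mem_sphere, mem_univ, true_and, Subtype.exists, exists_prop]
  constructor
  · rintro ⟨y, hy, rfl⟩
    rw [dist_eq_norm] at hy
    refine ⟨r⁻¹ • (y - x₀), ?_, ?_⟩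
    · rw [dist_zero_right, norm_smul, norm_inv, Real.norm_eq_abs, abs_of_pos hr, hy,
        inv_mul_cancel₀ hr.ne']
    · congr 1
      rw [smul_smul, mul_inv_cancel₀ hr.ne', one_smul, add_sub_cancel]
  · rintro ⟨ξ, hξ, rfl⟩
    refine ⟨x₀ + r • ξ, ?_, rfl⟩
    rw [dist_zero_right] at hξ
    rw [dist_eq_norm, add_sub_cancel_left, norm_smul, Real.norm_eq_abs, abs_of_pos hr, hξ, mul_one]

/-- Joint continuity of `(r, ξ) ↦ T (x₀ + r ξ)` on `(0,∞) × S²` when `T` is continuous off `x₀`. -/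
lemma nf5_continuous_param (T : E3 → ℝ) (x₀ : E3) (hT : ContinuousOn T ({x₀}ᶜ : Set E3)) :
    Continuous (fun p : (Ioi (0 : ℝ)) × (Metric.sphere (0 : E3) 1) =>
      T (x₀ + (p.1 : ℝ) • (p.2 : E3))) := by
  have hf : Continuous (fun p : (Ioi (0 : ℝ)) × (Metric.sphere (0 : E3) 1) =>
      x₀ + (p.1 : ℝ) • (p.2 : E3)) :=
    continuous_const.add
      ((continuous_subtype_val.comp continuous_fst).smul (continuous_subtype_val.comp continuous_snd))
  refine hT.comp_continuous hf ?_
  intro p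
  have hξ : ‖(p.2 : E3)‖ = 1 := by
    have := p.2.2
    rwa [mem_sphere_zero_iff_norm] at this
  have hξ0 : (p.2 : E3) ≠ 0 := by
    intro h; rw [h, norm_zero] at hξ; exact zero_ne_one hξ
  have hr0 : (p.1 : ℝ) ≠ 0 := ne_of_gt p.1.2
  simp only [mem_compl_iff, mem_singleton_iff, add_eq_left]
  exact smul_ne_zero hr0 hξ0

lemma nf5_continuousOn_sphSup (T : E3 → ℝ) (x₀ : E3) (hT : ContinuousOn T ({x₀}ᶜ : Set E3)) :
    ContinuousOn (fun r => sphSup T x₀ r) (Ioi 0) := by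
  rw [continuousOn_iff_continuous_restrict]
  have h := IsCompact.continuous_sSup (isCompact_univ : IsCompact (univ : Set (Metric.sphere (0 : E3) 1)))
    (f := fun (r : Ioi (0 : ℝ)) (ξ : Metric.sphere (0 : E3) 1) => T (x₀ + (r : ℝ) • (ξ : E3)))
    (nf5_continuous_param T x₀ hT)
  convert h using 1
  funext r
  simp only [restrict_apply, sphSup]
  rw [nf5_image_sphere_eq T x₀ r.2]

lemma nf5_continuousOn_sphInf (T : E3 → ℝ) (x₀ : E3) (hT : ContinuousOn T ({x₀}ᶜ : Set E3)) :
    ContinuousOn (fun r => sphInf T x₀ r) (Ioi 0) := by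
  rw [continuousOn_iff_continuous_restrict]
  have h := IsCompact.continuous_sInf (isCompact_univ : IsCompact (univ : Set (Metric.sphere (0 : E3) 1)))
    (f := fun (r : Ioi (0 : ℝ)) (ξ : Metric.sphere (0 : E3) 1) => T (x₀ + (r : ℝ) • (ξ : E3)))
    (nf5_continuous_param T x₀ hT)
  convert h using 1
  funext r
  simp only [restrict_apply, sphInf]
  rw [nf5_image_sphere_eq T x₀ r.2]

lemma nf5_continuousOn_netFlux (T : E3 → ℝ) (x₀ : E3) (hT : ContinuousOn T ({x₀}ᶜ : Set E3)) :
    ContinuousOn (netFlux T x₀) (Ioi 0) := by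
  have h := (nf5_continuousOn_sphSup T x₀ hT).sub (nf5_continuousOn_sphInf T x₀ hT)
  exact continuousOn_id.mul h

/-- A point on the sphere of radius `r ≥ 0`. -/
lemma nf5_sphere_nonempty (x₀ : E3) {r : ℝ} (hr : 0 ≤ r) : (Metric.sphere x₀ r).Nonempty :=
  (NormedSpace.sphere_nonempty).mpr hr

lemma nf5_sphInf_le (T : E3 → ℝ) (x₀ : E3) {C : ℝ} (hC : ∀ x, |T x| ≤ C) {r : ℝ} {y : E3}
    (hy : y ∈ Metric.sphere x₀ r) : sphInf T x₀ r ≤ T y :=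
  csInf_le ⟨-C, by rintro _ ⟨z, _, rfl⟩; exact neg_le_of_abs_le (hC z)⟩ (mem_image_of_mem T hy)

lemma nf5_le_sphSup (T : E3 → ℝ) (x₀ : E3) {C : ℝ} (hC : ∀ x, |T x| ≤ C) {r : ℝ} {y : E3}
    (hy : y ∈ Metric.sphere x₀ r) : T y ≤ sphSup T x₀ r :=
  le_csSup ⟨C, by rintro _ ⟨z, _, rfl⟩; exact le_of_abs_le (hC z)⟩ (mem_image_of_mem T hy)

lemma nf5_sphOsc_nonneg (T : E3 → ℝ) (x₀ : E3) {C : ℝ} (hC : ∀ x, |T x| ≤ C) {r : ℝ} (hr : 0 ≤ r) :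
    0 ≤ sphOsc T x₀ r := by
  obtain ⟨y, hy⟩ := nf5_sphere_nonempty x₀ hr
  have := (nf5_sphInf_le T x₀ hC hy).trans (nf5_le_sphSup T x₀ hC hy)
  unfold sphOsc; linarith

lemma nf5_sphOsc_le (T : E3 → ℝ) (x₀ : E3) {C : ℝ} (hC : ∀ x, |T x| ≤ C) {r : ℝ} (hr : 0 ≤ r) :
    sphOsc T x₀ r ≤ 2 * C := by
  obtain ⟨y, hy⟩ := nf5_sphere_nonempty x₀ hr
  have hne : (T '' Metric.sphere x₀ r).Nonempty := ⟨T y, mem_image_of_mem T hy⟩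
  have h1 : sphSup T x₀ r ≤ C :=
    csSup_le hne (by rintro _ ⟨z, _, rfl⟩; exact le_of_abs_le (hC z))
  have h2 : -C ≤ sphInf T x₀ r :=
    le_csInf hne (by rintro _ ⟨z, _, rfl⟩; exact neg_le_of_abs_le (hC z))
  unfold sphOsc; linarith

/-- From `∫₀ᴿ netFlux ≤ 0` for all `R`: the oscillation vanishes on every sphere of positive radius. -/
lemma nf5_sphOsc_eq_zero (T : E3 → ℝ) (x₀ : E3) (hT : ContinuousOn T ({x₀}ᶜ : Set E3))
    {C : ℝ} (hC : ∀ x, |T x| ≤ C) (hint : ∀ R > 0, ∫ r in Ioo 0 R, netFlux T x₀ r ≤ 0)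
    {r : ℝ} (hr : 0 < r) : sphOsc T x₀ r = 0 := by
  set R : ℝ := r + 1 with hRdef
  have hR : 0 < R := by linarith
  have hrR : r ∈ Ioo 0 R := ⟨hr, by linarith⟩
  set f : ℝ → ℝ := netFlux T x₀ with hf
  have hnn : ∀ s ∈ Ioo 0 R, 0 ≤ f s := fun s hs =>
    mul_nonneg hs.1.le (nf5_sphOsc_nonneg T x₀ hC hs.1.le)
  have hbd : ∀ s ∈ Ioo 0 R, ‖f s‖ ≤ R * (2 * C) := by
    intro s hs
    have h0 : 0 ≤ f s := hnn s hs
    rw [Real.norm_eq_abs, abs_of_nonneg h0]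
    have h1 : sphOsc T x₀ s ≤ 2 * C := nf5_sphOsc_le T x₀ hC hs.1.le
    have h2 : 0 ≤ sphOsc T x₀ s := nf5_sphOsc_nonneg T x₀ hC hs.1.le
    calc f s = s * sphOsc T x₀ s := rfl
      _ ≤ R * sphOsc T x₀ s := by apply mul_le_mul_of_nonneg_right hs.2.le h2
      _ ≤ R * (2 * C) := by apply mul_le_mul_of_nonneg_left h1 hR.le
  have hcont : ContinuousOn f (Ioo 0 R) := (nf5_continuousOn_netFlux T x₀ hT).mono Ioo_subset_Ioi_self
  have hmeas : AEStronglyMeasurable f (volume.restrict (Ioo 0 R)) :=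
    hcont.aestronglyMeasurable measurableSet_Ioo
  haveI : IsFiniteMeasure (volume.restrict (Ioo (0 : ℝ) R)) := by
    rw [isFiniteMeasure_restrict]; simp [Real.volume_Ioo]
  have hfi : IntegrableOn f (Ioo 0 R) volume := by
    have hg : Integrable (fun _ : ℝ => R * (2 * C)) (volume.restrict (Ioo 0 R)) := integrable_const _
    exact hg.mono' hmeas (ae_restrict_of_forall_mem measurableSet_Ioo hbd)
  have hae : 0 ≤ᵐ[volume.restrict (Ioo 0 R)] f :=
    ae_restrict_of_forall_mem measurableSet_Ioo hnn
  -- if `f r > 0`, the integral is positive: contradiction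
  by_contra hne
  have hpos : 0 < f r := by
    have h0 : 0 ≤ f r := hnn r hrR
    have hne' : f r ≠ 0 := by
      intro h
      have : sphOsc T x₀ r = 0 := by
        have := mul_eq_zero.mp h
        rcases this with h | h
        · exact absurd h hr.ne'
        · exact h
      exact hne this
    exact lt_of_le_of_ne h0 (Ne.symm hne')
  -- a neighbourhood of `r` inside `(0,R)` where `f > f r / 2`
  have hev : ∀ᶠ s in 𝓝 r, f r / 2 < f s ∧ s ∈ Ioo 0 R := by
    have h1 : ∀ᶠ s in 𝓝 r, f r / 2 < f s :=
      (hcont.continuousAt (Ioo_mem_nhds hrR.1 hrR.2)).eventually (lt_mem_nhds (by linarith))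
    exact h1.and (Ioo_mem_nhds hrR.1 hrR.2)
  obtain ⟨ε, hε, hball⟩ := Metric.eventually_nhds_iff_ball.mp hev
  have hsub : Ioo (r - ε) (r + ε) ⊆ support f ∩ Ioo 0 R := by
    intro s hs
    have hs' : s ∈ Metric.ball r ε := by rw [Real.ball_eq_Ioo]; exact hs
    obtain ⟨h1, h2⟩ := hball s hs'
    exact ⟨(by have : 0 < f s := by linarith
               exact this.ne'), h2⟩
  have hμ : 0 < volume (support f ∩ Ioo 0 R) := by
    apply lt_of_lt_of_le _ (measure_mono hsub)
    rw [Real.volume_Ioo]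
    exact ENNReal.ofReal_pos.mpr (by linarith)
  have hint_pos : 0 < ∫ s in Ioo 0 R, f s :=
    (setIntegral_pos_iff_support_of_nonneg_ae hae hfi).mpr hμ
  exact absurd (hint R hR) (not_le.mpr hint_pos)

/-- `T` is constant on every sphere of positive radius about `x₀`. -/
lemma nf5_const_on_spheres (T : E3 → ℝ) (x₀ : E3) (hT : ContinuousOn T ({x₀}ᶜ : Set E3))
    {C : ℝ} (hC : ∀ x, |T x| ≤ C) (hint : ∀ R > 0, ∫ r in Ioo 0 R, netFlux T x₀ r ≤ 0)
    {y z : E3} (hyz : ‖y - x₀‖ = ‖z - x₀‖) (hy : y ≠ x₀) : T y = T z := by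
  set r := ‖y - x₀‖ with hrdef
  have hr : 0 < r := norm_pos_iff.mpr (sub_ne_zero.mpr hy)
  have hosc := nf5_sphOsc_eq_zero T x₀ hT hC hint hr
  have hy' : y ∈ Metric.sphere x₀ r := by rw [mem_sphere_iff_norm]
  have hz' : z ∈ Metric.sphere x₀ r := by rw [mem_sphere_iff_norm, ← hyz]
  have h1 := nf5_sphInf_le T x₀ hC hy'
  have h2 := nf5_le_sphSup T x₀ hC hy'
  have h3 := nf5_sphInf_le T x₀ hC hz'
  have h4 := nf5_le_sphSup T x₀ hC hz'
  unfold sphOsc at hosc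
  linarith

/-- **NF-5 PROVED (planner g3; V8 P3's two S-lemmas, merged and kernel-checked): vanishing cumulative net flux
forces a radial potential.**  Continuity of `r ↦ max / min over S_r` (compact unit sphere reparametrisation,
`IsCompact.continuous_sSup`), positivity of the integral of a continuous nonnegative function that is positive
somewhere, constancy on spheres, and rotation of `x` on its sphere (`s ↦ x₀ + cos s · y + sin s · w`) to kill the
tangential derivative. -/
theorem nf5_radial_of_netFluxLeZero : RadialOfNetFluxLeZero := by
  intro T x₀ hT ⟨C, hC⟩ hint x
  by_cases hx : x = x₀
  · subst hx; simp [cross]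
  set y : E3 := x - x₀ with hydef
  have hy0 : y ≠ 0 := sub_ne_zero.mpr hx
  have hTc : ContinuousOn T ({x₀}ᶜ : Set E3) := hT.continuousOn
  have hdiff : DifferentiableAt ℝ T x :=
    (hT.differentiableOn one_ne_zero).differentiableAt (isOpen_compl_singleton.mem_nhds hx)
  have hfd : HasFDerivAt T (fderiv ℝ T x) x := hdiff.hasFDerivAt
  -- Step 1: the derivative of `T` at `x` kills every `w ⊥ y` with `‖w‖ = ‖y‖` (rotate `x` on its sphere)
  have key : ∀ w : E3, ⟪w, y⟫ = 0 → ‖w‖ = ‖y‖ → fderiv ℝ T x w = 0 := by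
    intro w hwy hwn
    set γ : ℝ → E3 := fun s => x₀ + (Real.cos s • y + Real.sin s • w) with hγ
    have hγ0 : γ 0 = x := by simp [hγ, hydef]
    have hγd : HasDerivAt γ w 0 := by
      have h1 : HasDerivAt (fun s => Real.cos s • y) (-Real.sin 0 • y) 0 :=
        (Real.hasDerivAt_cos 0).smul_const y
      have h2 : HasDerivAt (fun s => Real.sin s • w) (Real.cos 0 • w) 0 :=
        (Real.hasDerivAt_sin 0).smul_const w
      have h := (h1.add h2).const_add x₀
      simp only [Real.sin_zero, neg_zero, zero_smul, Real.cos_zero, one_smul, zero_add] at h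
      exact h
    -- `γ` stays on the sphere through `x`
    have hsph : ∀ s, ‖γ s - x₀‖ = ‖y‖ := by
      intro s
      have hγs : γ s - x₀ = Real.cos s • y + Real.sin s • w := by
        simp only [hγ, add_sub_cancel_left]
      have hsq : ‖γ s - x₀‖ ^ 2 = ‖y‖ ^ 2 := by
        rw [hγs, norm_add_sq_real, norm_smul, norm_smul, real_inner_smul_left, real_inner_smul_right,
          real_inner_comm, hwy, hwn, Real.norm_eq_abs, Real.norm_eq_abs, mul_pow, mul_pow, sq_abs, sq_abs]
        nlinarith [Real.cos_sq_add_sin_sq s]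
      have h1 : 0 ≤ ‖γ s - x₀‖ := norm_nonneg _
      have h2 : 0 ≤ ‖y‖ := norm_nonneg _
      nlinarith [hsq, h1, h2, sq_nonneg (‖γ s - x₀‖ - ‖y‖), sq_nonneg (‖γ s - x₀‖ + ‖y‖)]
    have hconst : ∀ s, T (γ s) = T x := by
      intro s
      have hne : γ s ≠ x₀ := by
        intro h
        have := hsph s
        rw [h, sub_self, norm_zero] at this
        exact hy0 (norm_eq_zero.mp this.symm)
      exact nf5_const_on_spheres T x₀ hTc hC hint (by rw [hsph s, hydef]) hne
    have hcomp : HasDerivAt (T ∘ γ) (fderiv ℝ T x w) 0 := by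
      have h2 : HasFDerivAt T (fderiv ℝ T x) (γ 0) := by rw [hγ0]; exact hfd
      exact h2.comp_hasDerivAt 0 hγd
    have hfun : T ∘ γ = fun _ => T x := funext fun s => hconst s
    rw [hfun] at hcomp
    exact hcomp.unique (hasDerivAt_const 0 (T x))
  -- Step 2: hence every `w ⊥ y`
  have key' : ∀ w : E3, ⟪w, y⟫ = 0 → fderiv ℝ T x w = 0 := by
    intro w hwy
    by_cases hw : w = 0
    · simp [hw]
    have hwn : 0 < ‖w‖ := norm_pos_iff.mpr hw
    set c : ℝ := ‖y‖ / ‖w‖ with hc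
    have hcpos : 0 < c := div_pos (norm_pos_iff.mpr hy0) hwn
    have h1 : ⟪c • w, y⟫ = 0 := by rw [real_inner_smul_left, hwy, mul_zero]
    have h2 : ‖c • w‖ = ‖y‖ := by
      rw [norm_smul, Real.norm_eq_abs, abs_of_pos hcpos, hc, div_mul_cancel₀ _ hwn.ne']
    have h3 := key (c • w) h1 h2
    rw [map_smul, smul_eq_mul] at h3
    rcases mul_eq_zero.mp h3 with h | h
    · exact absurd h hcpos.ne'
    · exact h
  -- Step 3: the gradient is radial
  set G : E3 := gradient T x with hG
  have hGw : ∀ w : E3, ⟪w, y⟫ = 0 → ⟪G, w⟫ = 0 := by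
    intro w hwy
    rw [hG, gradient, InnerProductSpace.toDual_symm_apply]
    exact key' w hwy
  have hyy : ⟪y, y⟫ ≠ 0 := by
    rw [real_inner_self_eq_norm_sq]; positivity
  set c : ℝ := ⟪G, y⟫ / ⟪y, y⟫ with hc
  set b : E3 := G - c • y with hb
  have hby : ⟪b, y⟫ = 0 := by
    rw [hb, inner_sub_left, real_inner_smul_left, hc, div_mul_cancel₀ _ hyy, sub_self]
  have hGb : ⟪G, b⟫ = 0 := hGw b hby
  have hbb : ⟪b, b⟫ = 0 := by
    have : ⟪b, b⟫ = ⟪G, b⟫ - c * ⟪y, b⟫ := by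
      rw [hb, inner_sub_left, real_inner_smul_left]
    rw [this, hGb, real_inner_comm, hby, mul_zero, sub_zero]
  have hb0 : b = 0 := inner_self_eq_zero.mp hbb
  have hGy : G = c • y := by rw [← sub_eq_zero]; exact hb0
  -- Step 4: `(c y) × y = 0`
  rw [hGy]
  simp only [cross, WithLp.ofLp_smul, LinearMap.map_smul, LinearMap.smul_apply, cross_self, smul_zero,
    WithLp.toLp_zero]

/-! ### §2 Proved glue: S⁺ ⇒ the unimodal Type-I target (the ancient limit `t₁ → −∞`) -/

/-- **S⁺ gives the target (PROVED; its inputs NF-2 and NF-5 are a landed theorem and §1b).**  For ancient data the window bound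
`∫₀ᴿ netFlux(T(t)) ≤ A C₁ (1 + R/√(−t))³ (t/t₁)^λ` holds for EVERY `t₁ ≤ t`; choosing `t₁ = t · δ^{−1/λ}` makes the
right side `K δ`, so `∫₀ᴿ netFlux(T(t)) ≤ 0` for all `R`, and NF-5 turns this into `∇T(t) × (x − x₀) = 0`. -/
theorem liouville_of_windowDecay (hW : NetFluxWindowDecay) (hV : TypeIVorticityBound)
    (hrad : RadialOfNetFluxLeZero) : UnimodalScalarLiouvilleTypeI := by
  intro v x₀ T hC hB hm hsv hsT hTb hrep hE huni t ht
  obtain ⟨C, hCv⟩ := hC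
  have hC0 : 0 ≤ C := FarPastCollapse.typeI_const_nonneg hCv
  obtain ⟨C₁, hC₁⟩ := hV v C hB hCv hsv
  obtain ⟨lam, hlam, A, hA⟩ := hW C hC0
  -- slice regularity of `T t` off the centre
  have hT1 : ContDiffOn ℝ 1 (T t) ({x₀}ᶜ : Set E3) := by
    have h1 : ContDiffOn ℝ 1 (uncurry T) (Iio 0 ×ˢ ({x₀}ᶜ : Set E3)) :=
      hsT.of_le (by exact_mod_cast le_top)
    have h2 : ContDiffOn ℝ 1 (fun x : E3 => (t, x)) ({x₀}ᶜ : Set E3) :=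
      contDiffOn_const.prodMk contDiffOn_id
    exact h1.comp h2 (fun x hx => Set.mk_mem_prod ht hx)
  obtain ⟨CT, hCT⟩ := hTb
  refine hrad (T t) x₀ hT1 ⟨CT, fun x => hCT t ht x⟩ ?_
  intro R hR
  -- the window bound for every earlier start `t₁ ≤ t`
  have key : ∀ t₁ : ℝ, t₁ ≤ t →
      ∫ r in Ioo 0 R, netFlux (T t) x₀ r ≤ A * C₁ * (1 + R / Real.sqrt (-t)) ^ 3 * (t / t₁) ^ lam := by
    intro t₁ ht₁
    have ht₀ : t₁ - 1 < 0 := by linarith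
    have hsub : Ioo (t₁ - 1) 0 ⊆ Iio (0 : ℝ) := fun s hs => hs.2
    exact hA v x₀ T C₁ (t₁ - 1) ht₀ (hsv.mono (Set.prod_mono hsub Subset.rfl))
      (hsT.mono (Set.prod_mono hsub Subset.rfl)) (fun s hs y => hCv s hs.2 y) (fun s hs y => hC₁ s hs.2 y)
      (fun s hs y => hrep s hs.2 y) (fun s hs y hy => hE s hs.2 y hy) (fun s hs r hr => huni s hs.2 r hr)
      t₁ t R (by linarith) ht₁ ht hR
  set J : ℝ := ∫ r in Ioo 0 R, netFlux (T t) x₀ r with hJ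
  set K : ℝ := A * C₁ * (1 + R / Real.sqrt (-t)) ^ 3 with hK
  by_cases hKle : K ≤ 0
  · have h1 := key t le_rfl
    have h1' : (t / t) ^ lam = 1 := by rw [div_self ht.ne]; exact Real.one_rpow lam
    rw [h1', mul_one] at h1
    exact h1.trans hKle
  · push Not at hKle
    by_contra hJpos
    push Not at hJpos
    obtain ⟨δ, hδ⟩ : ∃ δ : ℝ, δ = min 1 (J / (2 * K)) := ⟨_, rfl⟩
    have hδpos : 0 < δ := by rw [hδ]; exact lt_min one_pos (div_pos hJpos (by positivity))
    have hδle1 : δ ≤ 1 := by rw [hδ]; exact min_le_left _ _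
    have hδleJ : δ ≤ J / (2 * K) := by rw [hδ]; exact min_le_right _ _
    have hmul : δ * (2 * K) ≤ J := (le_div_iff₀ (by positivity)).mp hδleJ
    have hexp : (-(1 / lam) : ℝ) ≤ 0 := by rw [neg_nonpos]; positivity
    obtain ⟨k, hk⟩ : ∃ k : ℝ, k = δ ^ (-(1 / lam) : ℝ) := ⟨_, rfl⟩
    have hk1 : 1 ≤ k := by
      rw [hk]; exact Real.one_le_rpow_of_pos_of_le_one_of_nonpos hδpos hδle1 hexp
    have hkpos : 0 < k := lt_of_lt_of_le one_pos hk1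
    have htne : t ≠ 0 := ht.ne
    have ht₁ : t * k ≤ t := by nlinarith
    have h2 := key (t * k) ht₁
    have hratio : t / (t * k) = δ ^ (1 / lam : ℝ) := by
      rw [div_mul_eq_div_div, div_self htne, one_div, hk, Real.rpow_neg hδpos.le, inv_inv]
    rw [hratio, ← Real.rpow_mul hδpos.le, one_div_mul_cancel hlam.ne', Real.rpow_one] at h2
    nlinarith

/-- (v4 FALLBACK bookkeeping only; not on v5's path) g2's recorded `LineComposition` — the DISTRIBUTIONAL chain — is a theorem modulo the
v4 NF-4 `NetFluxSubsolution → OscLeVorticity → HalfLineOUDecay → NetFluxWindowDecay` (second implication kernel-checked, NF-5 proved). -/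
theorem lineComposition_of
    (h4 : NetFluxSubsolution → OscLeVorticity → HalfLineOUDecay → NetFluxWindowDecay) : LineComposition :=
  ⟨h4, fun hW hV => liouville_of_windowDecay hW hV nf5_radial_of_netFluxLeZero⟩

/-! ### §3 THE COMPOSITION (kernel-checked; hypotheses = the five v5 stub statements, in prover order; NF-0/NF-2 by name, NF-3ᵛ inside NF-4ᵛ, NF-5 proved above) -/

/-- **The line closes the rung.**  NF-1a, NF-1bᵛ, NF-1cᵛ, NF-6, NF-4ᵛ (+ the landed NF-0, NF-2, NF-3ᵛ and the proved NF-5) ⇒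
`UnimodalScalarLiouvilleTypeI`.  (RUNG, not the crux: see the module docstring.) -/
theorem UnimodalScalarLiouvilleTypeI_of
    (hA : ExtremalHeadEMF) (hE : EnvelopeFacts)
    (h1 : EnvelopeFacts → ExtremalHeadEMF → OneSidedNetFluxLaw)
    (hNC : NearCentreFlux)
    (h4 : OneSidedNetFluxLaw → OscLeVorticity → NearCentreFlux → NetFluxWindowDecay) :
    UnimodalScalarLiouvilleTypeI :=
  liouville_of_windowDecay (h4 (h1 hE hA) nf0_oscLeVorticity hNC) nf2_typeIVorticityBound nf5_radial_of_netFluxLeZero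

/-- Where the rung sits: the line's stubs + the typed RESIDUAL `MultiHillScalarLiouvilleTypeI` + the four v2
companion stubs (two of them landed) give C⁻ = `FarPastCollapse.PoloidalLiouvilleTypeI`, the statement route
UnthreadedDoor consumes (g0's `closes_typeI`).  Nothing here discharges the residual. -/
theorem poloidalLiouvilleTypeI_of_line
    (s₁ : FarPastCollapse.StubVorticityOfClass) (s₂ : FarPastCollapse.StubToroidalPotential)
    (s₃ : FarPastCollapse.StubPotentialEvolution) (s₅ : FarPastCollapse.StubConstantOfIrrotational)
    (hA : ExtremalHeadEMF) (hE : EnvelopeFacts)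
    (h1 : EnvelopeFacts → ExtremalHeadEMF → OneSidedNetFluxLaw)
    (hNC : NearCentreFlux)
    (h4 : OneSidedNetFluxLaw → OscLeVorticity → NearCentreFlux → NetFluxWindowDecay)
    (hres : MultiHillScalarLiouvilleTypeI) :
    FarPastCollapse.PoloidalLiouvilleTypeI :=
  poloidalLiouvilleTypeI_of_pieces s₁ s₂ s₃ s₅ (UnimodalScalarLiouvilleTypeI_of hA hE h1 hNC h4) hres

/-- The composition run on the registered stubs — v10: every `stub_*` is closed by name, so this RUNG theorem is SORRY-FREE
(the stratum «Type-I in time ∧ saddle-free spheres»; NOT the crux 1222, NOT C⁻, NOT the wall stub). -/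
theorem unimodalScalarLiouvilleTypeI_of_stubs : UnimodalScalarLiouvilleTypeI :=
  UnimodalScalarLiouvilleTypeI_of
    stub_extremalHeadEMF stub_envelopeFacts stub_oneSidedLaw_of_hinges stub_nearCentreFlux stub_windowDecay_viscosity

/-! ### §4 Anti-drift guard (V12 P4): the sketch's netflux objects and the Theorems-side Defs twin
(`Theorems/UnthreadedDoorNetFluxDefs.lean`, p660450) are DEFINITIONALLY EQUAL, twin by twin.  If either copy is
edited, one of these `rfl`s fails and this file stops checking — the by-name closures above cannot drift silently. -/

example : @sphSup = @Theorems.PoloidalLiouville.NetFlux.sphSup := rfl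
example : @sphInf = @Theorems.PoloidalLiouville.NetFlux.sphInf := rfl
example : @sphOsc = @Theorems.PoloidalLiouville.NetFlux.sphOsc := rfl
example : @netFlux = @Theorems.PoloidalLiouville.NetFlux.netFlux := rfl
example : @IsUnimodalSphere = @Theorems.PoloidalLiouville.NetFlux.IsUnimodalSphere := rfl
example : @CurledLaw = @Theorems.PoloidalLiouville.NetFlux.CurledLaw := rfl
example : NetFluxSubsolution ↔ Theorems.PoloidalLiouville.NetFlux.NetFluxSubsolution := Iff.rfl
example : OscLeVorticity ↔ Theorems.PoloidalLiouville.NetFlux.OscLeVorticity := Iff.rfl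
example : TypeIVorticityBound ↔ Theorems.PoloidalLiouville.NetFlux.TypeIVorticityBound := Iff.rfl
example : HalfLineOUDecay ↔ Theorems.PoloidalLiouville.NetFlux.HalfLineOUDecay := Iff.rfl
example : NetFluxWindowDecay ↔ Theorems.PoloidalLiouville.NetFlux.NetFluxWindowDecay := Iff.rfl
example : UnimodalScalarLiouvilleTypeI ↔ Theorems.PoloidalLiouville.NetFlux.UnimodalScalarLiouvilleTypeI := Iff.rfl
example : MultiHillScalarLiouvilleTypeI ↔ Theorems.PoloidalLiouville.NetFlux.MultiHillScalarLiouvilleTypeI := Iff.rfl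
example : LineComposition ↔ Theorems.PoloidalLiouville.NetFlux.LineComposition := Iff.rfl
-- v5: twins in qj-p1's `Theorems/UnthreadedDoorNetFluxEnvelopeDefs.lean` (p662148)
example : @sphArgmax = @Theorems.PoloidalLiouville.NetFlux.sphArgmax := rfl
example : @sphArgmin = @Theorems.PoloidalLiouville.NetFlux.sphArgmin := rfl
example : @radDeriv = @Theorems.PoloidalLiouville.NetFlux.radDeriv := rfl
example : @radDeriv2 = @Theorems.PoloidalLiouville.NetFlux.radDeriv2 := rfl
example : ExtremalHeadEMF ↔ Theorems.PoloidalLiouville.NetFlux.ExtremalHeadEMF := Iff.rfl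
-- v6: NF-1bᵛ by name — the line's `EnvelopeFacts` IS the type of the landed theorem (definitional unfolding).
example : EnvelopeFacts := stub_envelopeFacts
example : NearCentreFlux := stub_nearCentreFlux   -- v7: NF-6 closed by name (p668552)
example : OneSidedNetFluxLaw → OscLeVorticity → NearCentreFlux → NetFluxWindowDecay := stub_windowDecay_viscosity   -- v8: NF-4ᵛ by name (p669139)
example : EnvelopeFacts → ExtremalHeadEMF → OneSidedNetFluxLaw := stub_oneSidedLaw_of_hinges   -- v9: NF-1cᵛ by name (p673578)
example : ExtremalHeadEMF := stub_extremalHeadEMF   -- v10: NF-1a by name (p675379)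
example : UnimodalScalarLiouvilleTypeI := unimodalScalarLiouvilleTypeI_of_stubs   -- v10: the rung, sorry-free (this file)
example : UnimodalScalarLiouvilleTypeI := Theorems.PoloidalLiouville.NetFlux.unimodalScalarLiouvilleTypeI_holds   -- v10: the rung BY NAME, Theorems side (p675773)
example : OneSidedNetFluxLaw ↔ Theorems.PoloidalLiouville.NetFlux.OneSidedNetFluxLaw := Iff.rfl
example : RadialOfNetFluxLeZero ↔ Theorems.PoloidalLiouville.NetFlux.RadialOfNetFluxLeZero := Iff.rfl

end Summit.NavierStokesRegularity.NavierStokesRegularity.Cruxes.PoloidalLiouville.NetFlux
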